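import Literature.Computability.MetaComplexity.EFModAddAssocQuot
import HarnessLib

/-!
# Modular addition in extended Frege: associativity, IV — assembly

Layer D/4d of the `EF`-proof construction kit: the associativity law of modular addition,
`(x ⊕ₙ y) ⊕ₙ z = x ⊕ₙ (y ⊕ₙ z)` for `y, z < n` (and the intermediate results in range), derived
inside Frege in polynomial size (`ModAdd.assoc`). With the split identities
(`EFModAddSplit.lean`) of the four occurrences, the identity between the ordinary sums
(`EFModAddAssocMain.lean`) and the quotient lines of both sides (`EFModAddAssocQuot.lean`), the
rule `rQuot` gives `G₁ + G₂ = G₃ + G₄` for the four selectors, and a bitwise cancellation pass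
(`rCancStep`, `rCancEq`) along `(L' + G₂n) + G₁n = (R' + G₄n) + G₃n` yields `L = R`.

## Sources

* S. A. Cook, R. A. Reckhow, *The relative efficiency of propositional proof systems*,
  J. Symbolic Logic 44 (1979), §2 (sound schematic rules).
* J. Krajíček, *Bounded Arithmetic, Propositional Logic, and Complexity Theory* (CUP 1995), §9.2.
-/

namespace Literature.Computability.MetaComplexity

open _root_.Computability Complexity Complexity.PropForm FregeSystem Netlist

namespace ModAdd

namespace Assoc

open SplitAux AssocMain AssocQuot

variable {G : FregeSystem} {K : PropForm ℕ} {Γ : Set (PropForm ℕ)} {W : ℕ} {o₁ o₂ o₃ o₄ b₁ b₂ b₃ b₄ m qL qR : Occ}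

/-- The base of `VL` inside the main auxiliary occurrence. [folklore] -/
def bL (W : ℕ) (m : Occ) : ℕ := m.base + (8 * W + 16)

/-- The base of `VR` inside the main auxiliary occurrence. [folklore] -/
def bR (W : ℕ) (m : Occ) : ℕ := m.base + (18 * W + 37)

/-! ### Equality of the comparison bits of both sides -/

/-- **The comparators of both sides agree**: `[VL ≥ n] ↔ [VR ≥ n]` and `[VL ≥ 2n] ↔ [VR ≥ 2n]`, by
congruence from `s(VL) = s(VR)`, the (false) top carries, and the congruence of the two adders
`n + n`. [cite: CookReckhow1979, §2] -/
theorem eqG (hG : ARulesOK G) (qvL : QuotViews W o₁ o₁ o₂ b₁ b₂ qL (bL W m) K Γ) (qvR : QuotViews W o₁ o₃ o₄ b₃ b₄ qR (bR W m) K Γ)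
    (hmain : Holds K Γ (eqW (VL W o₁ o₂ b₁ b₂ m).s (VR W o₁ o₃ o₄ b₃ b₄ m).s (W + 2)))
    (hcc : ctx K (eqv ((VL W o₁ o₂ b₁ b₂ m).c (W + 2)) ((VR W o₁ o₃ o₄ b₃ b₄ m).c (W + 2))) ∈ Γ) (hf₁ : ctx K (neg (var (f W o₁))) ∈ Γ) :
    G.Yields Γ ({ctx K (eqv ((tD W o₁ o₁ o₂ b₁ b₂ qL (bL W m)).S₁.ge (W + 3) (W + 3)) ((tD W o₁ o₃ o₄ b₃ b₄ qR (bR W m)).S₁.ge (W + 3) (W + 3)))} ∪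
      {ctx K (eqv ((tD W o₁ o₁ o₂ b₁ b₂ qL (bL W m)).S₃.ge (W + 3) (W + 3)) ((tD W o₁ o₃ o₄ b₃ b₄ qR (bR W m)).S₃.ge (W + 3) (W + 3)))})
      ((12 * W + 40) * (K.size + 10)) := by
  -- g1: reflexivity of `next`, of `n`, and `fz ↔ fz`
  have g1 := ((Yields.eqW_refl hG.adder K (next W o₁) (W + 3) (Γ := Γ)).union (Yields.eqW_refl hG.adder K (nv W o₁) W)).union
    (eqvFF hG (x := f W o₁) (y := f W o₁) hf₁ hf₁)
  set A1 := (ctxSet K (eqW (next W o₁) (next W o₁) (W + 3)) ∪ ctxSet K (eqW (nv W o₁) (nv W o₁) W)) ∪ {ctx K (eqv (f W o₁) (f W o₁))} with hA1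
  -- g2: congruence of the two adders `n + n`
  have g2 : G.Yields (Γ ∪ A1) {χ | χ ∈ Adder.leibLines (NNv W o₁ qL) (NNv W o₁ qR) K W} ((2 * W + 1) * (K.size + 10)) :=
    Yields.of_isBlock (Adder.isBlock_leibLines hG.netlist (NNv W o₁ qL) (NNv W o₁ qR) (qvL.nn.mono Set.subset_union_left)
      (qvR.nn.mono Set.subset_union_left) (fun i hi => Or.inr (Or.inl (Or.inr (mem_ctxSet (mem_eqW hi))))) fun i hi =>
      Or.inr (Or.inl (Or.inr (mem_ctxSet (mem_eqW hi))))) subset_rfl (Adder.proofSize_leibLines _ _ _ _)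
  set A2 := A1 ∪ {χ | χ ∈ Adder.leibLines (NNv W o₁ qL) (NNv W o₁ qR) K W} with hA2
  have hx : ∀ i < W + 3, ctx K (eqv (Adder.extOut (Vv W o₁ o₁ o₂ b₁ b₂ (bL W m)) (W + 2) i) (Adder.extOut (Vv W o₁ o₃ o₄ b₃ b₄ (bR W m)) (W + 2) i)) ∈
      Γ ∪ A2 := fun i hi => by
    rcases Nat.lt_succ_iff_lt_or_eq.1 hi with hi' | hi'
    · rw [Adder.extOut_lt _ hi', Adder.extOut_lt _ hi']; exact Or.inl (holds_eqW_iff.1 hmain i hi')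
    · rw [hi', Adder.extOut_top, Adder.extOut_top]; exact Or.inl hcc
  -- g3: congruence of the comparators with `n`
  have g3 : G.Yields (Γ ∪ A2) {χ | χ ∈ Sub.leibLines (tD W o₁ o₁ o₂ b₁ b₂ qL (bL W m)).S₁ (tD W o₁ o₃ o₄ b₃ b₄ qR (bR W m)).S₁ K (W + 3)}
      ((3 * (W + 3) + 1) * (K.size + 10)) :=
    Yields.of_isBlock (Sub.isBlock_leibLines hG.netlist hG.logic _ _ (qvL.cv1.mono Set.subset_union_left) (qvR.cv1.mono Set.subset_union_left) hx
      fun i hi => Or.inr (Or.inl (Or.inl (Or.inl (mem_ctxSet (mem_eqW hi)))))) subset_rfl (Sub.proofSize_leibLines _ _ _ _)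
  set A3 := A2 ∪ {χ | χ ∈ Sub.leibLines (tD W o₁ o₁ o₂ b₁ b₂ qL (bL W m)).S₁ (tD W o₁ o₃ o₄ b₃ b₄ qR (bR W m)).S₁ K (W + 3)} with hA3
  -- g4: congruence of the comparators with `2n`
  have g4 : G.Yields (Γ ∪ A3) {χ | χ ∈ Sub.leibLines (tD W o₁ o₁ o₂ b₁ b₂ qL (bL W m)).S₃ (tD W o₁ o₃ o₄ b₃ b₄ qR (bR W m)).S₃ K (W + 3)}
      ((3 * (W + 3) + 1) * (K.size + 10)) := by
    refine Yields.of_isBlock (Sub.isBlock_leibLines hG.netlist hG.logic _ _ (qvL.cv2.mono Set.subset_union_left) (qvR.cv2.mono Set.subset_union_left)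
      (fun i hi => (hx i hi).elim Or.inl fun h => Or.inr (Or.inl h)) fun i hi => ?_) subset_rfl (Sub.proofSize_leibLines _ _ _ _)
    show ctx K (eqv (N2e W o₁ qL i) (N2e W o₁ qR i)) ∈ Γ ∪ A3
    by_cases h0 : i < W
    · rw [N2e, N2e, Adder.zext_lt _ _ (by omega), Adder.zext_lt _ _ (by omega), Adder.extOut_lt _ h0, Adder.extOut_lt _ h0]
      exact Or.inr (Or.inl (Or.inr (Adder.mem_leibLines (k := 2 * i + 1) (by omega))))
    · by_cases h1 : i = W
      · rw [h1, N2e, N2e, Adder.zext_lt _ _ (Nat.lt_succ_self W), Adder.zext_lt _ _ (Nat.lt_succ_self W), Adder.extOut_top, Adder.extOut_top]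
        exact Or.inr (Or.inl (Or.inr (Adder.mem_leibLines (k := 2 * W) (by omega))))
      · rw [N2e, N2e, zext_ge _ _ (by omega), zext_ge _ _ (by omega)]; exact Or.inr (Or.inl (Or.inl (Or.inr rfl)))
  have h := ((g1.trans g2).trans g3).trans g4
  refine (h.mono_right ?_).mono_size (by nlinarith [Nat.zero_le W, Nat.zero_le K.size])
  rintro θ (hθ | hθ)
  · rw [Set.mem_singleton_iff.1 hθ]; exact Or.inl (Or.inr (ge_mem_leibLines _ _ _ _))
  · rw [Set.mem_singleton_iff.1 hθ]; exact Or.inr (ge_mem_leibLines _ _ _ _)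

/-! ### The cancellation pass -/

/-- The carry invariant at position `j`. [folklore] -/
def inv (W : ℕ) (o₁ o₂ o₃ o₄ b₁ b₂ b₃ b₄ m : Occ) (j : ℕ) : PropForm ℕ :=
  Adder.invF (var ((P W o₂ b₂).c j)) (var ((VL W o₁ o₂ b₁ b₂ m).c j)) (var ((P W o₄ b₄).c j)) (var ((VR W o₁ o₃ o₄ b₃ b₄ m).c j))

/-- The lines of the pass: even indices `2j` carry the invariant at `j`, odd indices `2i+1` the
equality `Lᵢ ↔ Rᵢ`. [folklore] -/
def passBody (W : ℕ) (o₁ o₂ o₃ o₄ b₁ b₂ b₃ b₄ m : Occ) (t : ℕ) : PropForm ℕ :=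
  if t % 2 = 0 then inv W o₁ o₂ o₃ o₄ b₁ b₂ b₃ b₄ m (t / 2) else eqv (u W o₂ (t / 2)) (u W o₄ (t / 2))

/-- Even lines. [folklore] -/
theorem passBody_even {t : ℕ} (h : t % 2 = 0) : passBody W o₁ o₂ o₃ o₄ b₁ b₂ b₃ b₄ m t = inv W o₁ o₂ o₃ o₄ b₁ b₂ b₃ b₄ m (t / 2) := by
  unfold passBody; rw [if_pos h]

/-- Odd lines. [folklore] -/
theorem passBody_odd {t : ℕ} (h : t % 2 = 1) : passBody W o₁ o₂ o₃ o₄ b₁ b₂ b₃ b₄ m t = eqv (u W o₂ (t / 2)) (u W o₄ (t / 2)) := by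
  unfold passBody; rw [if_neg (by omega)]

/-- Sizes of the pass lines. [folklore] -/
theorem size_passBody (t : ℕ) : (passBody W o₁ o₂ o₃ o₄ b₁ b₂ b₃ b₄ m t).size ≤ 59 := by
  unfold passBody inv
  split_ifs
  · simp [Adder.invF, FregeSystem.size_biimp, size]
  · exact (size_eqv _ _).le.trans (by norm_num)

/-- The metavariable assignment of the cancellation step at position `i`. [folklore] -/
def σc (K : PropForm ℕ) (W : ℕ) (o₁ o₂ o₃ o₄ b₁ b₂ b₃ b₄ m : Occ) (i : ℕ) : ℕ → PropForm ℕ :=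
  FregeSystem.sub [K, var ((P W o₂ b₂).c i), var ((VL W o₁ o₂ b₁ b₂ m).c i), var ((P W o₄ b₄).c i), var ((VR W o₁ o₃ o₄ b₃ b₄ m).c i),
    var (sel W o₁), var (sel W o₂), var (sel W o₃), var (sel W o₄), var (u W o₂ i), var (u W o₄ i), var (nv W o₁ i),
    var (M b₂ i), var (M b₁ i), var (M b₄ i), var (M b₃ i),
    var ((P W o₂ b₂).s i), var ((P W o₂ b₂).c (i + 1)), var ((VL W o₁ o₂ b₁ b₂ m).s i), var ((VL W o₁ o₂ b₁ b₂ m).c (i + 1)),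
    var ((P W o₄ b₄).s i), var ((P W o₄ b₄).c (i + 1)), var ((VR W o₁ o₃ o₄ b₃ b₄ m).s i), var ((VR W o₁ o₃ o₄ b₃ b₄ m).c (i + 1))]

/-- **The premises of the cancellation step at position `i < W`** are available: the previous
invariant, the equality of quotients, the four mask definitions, the sum and carry definitions of
`P₂, VL, P₄, VR` at `i` (operands normalised), and `s_i(VL) ↔ s_i(VR)`. [folklore] -/
theorem cancPrems_avail (hsh : OShape W o₁ o₂ o₃ o₄) {S : Set (PropForm ℕ)} (hΓ : Γ ⊆ S) (sv₁ : SplitViews W o₁ b₁ K Γ)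
    (sv₂ : SplitViews W o₂ b₂ K Γ) (sv₃ : SplitViews W o₃ b₃ K Γ) (sv₄ : SplitViews W o₄ b₄ K Γ) (mv : MainViews W o₁ o₂ o₃ o₄ b₁ b₂ b₃ b₄ m K Γ)
    (hEQK : ctx K (Adder.invF (var (sel W o₁)) (var (sel W o₂)) (var (sel W o₃)) (var (sel W o₄))) ∈ Γ)
    (hmain : Holds K Γ (eqW (VL W o₁ o₂ b₁ b₂ m).s (VR W o₁ o₃ o₄ b₃ b₄ m).s (W + 2))) {i : ℕ} (hi : i < W)
    (hprev : ctx K (inv W o₁ o₂ o₃ o₄ b₁ b₂ b₃ b₄ m i) ∈ S) : ∀ p ∈ cancPrems, p.subst (σc K W o₁ o₂ o₃ o₄ b₁ b₂ b₃ b₄ m i) ∈ S := by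
  -- masks, with `n` of `o₁`
  have hm₂ := sv₂.mask i hi; rw [show nv W o₂ i = nv W o₁ i from hsh.h₂n i hi] at hm₂
  have hm₃ := sv₃.mask i hi; rw [show nv W o₃ i = nv W o₁ i from hsh.h₃n i hi] at hm₃
  have hm₄ := sv₄.mask i hi; rw [show nv W o₄ i = nv W o₁ i from hsh.h₄n i hi] at hm₄
  -- sum and carry definitions, operands normalised
  have hs₂ := (sv₂.adder.2 i (by omega)).1
  have hc₂ := (sv₂.adder.2 i (by omega)).2
  rw [Adder.View.sumDef, show (P W o₂ b₂).x i = u W o₂ i from Adder.zext_lt _ _ hi, show (P W o₂ b₂).y i = M b₂ i from Adder.zext_lt _ _ hi] at hs₂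
  rw [Adder.View.carryDef, show (P W o₂ b₂).x i = u W o₂ i from Adder.zext_lt _ _ hi, show (P W o₂ b₂).y i = M b₂ i from Adder.zext_lt _ _ hi] at hc₂
  have hs₄ := (sv₄.adder.2 i (by omega)).1
  have hc₄ := (sv₄.adder.2 i (by omega)).2
  rw [Adder.View.sumDef, show (P W o₄ b₄).x i = u W o₄ i from Adder.zext_lt _ _ hi, show (P W o₄ b₄).y i = M b₄ i from Adder.zext_lt _ _ hi] at hs₄
  rw [Adder.View.carryDef, show (P W o₄ b₄).x i = u W o₄ i from Adder.zext_lt _ _ hi, show (P W o₄ b₄).y i = M b₄ i from Adder.zext_lt _ _ hi] at hc₄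
  have hyL : (VL W o₁ o₂ b₁ b₂ m).y i = M b₁ i := by
    show Adder.zext (N₁ W o₁ b₁) (f W o₁) (W + 1) i = M b₁ i; rw [Adder.zext_lt _ _ (by omega), N₁, Adder.zext_lt _ _ hi]
  have hyR : (VR W o₁ o₃ o₄ b₃ b₄ m).y i = M b₃ i := by
    show Adder.zext (N₃ W o₃ b₃) (f W o₁) (W + 1) i = M b₃ i; rw [Adder.zext_lt _ _ (by omega), N₃, Adder.zext_lt _ _ hi]
  have hsL := (mv.vl.2 i (by omega)).1
  have hcL := (mv.vl.2 i (by omega)).2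
  rw [Adder.View.sumDef, show (VL W o₁ o₂ b₁ b₂ m).x i = (P W o₂ b₂).s i from Adder.extOut_lt _ (by omega), hyL] at hsL
  rw [Adder.View.carryDef, show (VL W o₁ o₂ b₁ b₂ m).x i = (P W o₂ b₂).s i from Adder.extOut_lt _ (by omega), hyL] at hcL
  have hsR := (mv.vr.2 i (by omega)).1
  have hcR := (mv.vr.2 i (by omega)).2
  rw [Adder.View.sumDef, show (VR W o₁ o₃ o₄ b₃ b₄ m).x i = (P W o₄ b₄).s i from Adder.extOut_lt _ (by omega), hyR] at hsR
  rw [Adder.View.carryDef, show (VR W o₁ o₃ o₄ b₃ b₄ m).x i = (P W o₄ b₄).s i from Adder.extOut_lt _ (by omega), hyR] at hcR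
  exact FregeSystem.prems_cons hprev (FregeSystem.prems_cons (hΓ hEQK) (FregeSystem.prems_cons (hΓ hm₂) (FregeSystem.prems_cons (hΓ (sv₁.mask i hi))
    (FregeSystem.prems_cons (hΓ hm₄) (FregeSystem.prems_cons (hΓ hm₃) (FregeSystem.prems_cons (hΓ hs₂) (FregeSystem.prems_cons (hΓ hc₂)
    (FregeSystem.prems_cons (hΓ hsL) (FregeSystem.prems_cons (hΓ hcL) (FregeSystem.prems_cons (hΓ hs₄) (FregeSystem.prems_cons (hΓ hc₄)
    (FregeSystem.prems_cons (hΓ hsR) (FregeSystem.prems_cons (hΓ hcR)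
    (FregeSystem.prems_cons (hΓ (holds_eqW_iff.1 hmain i (by omega))) FregeSystem.prems_nil))))))))))))))

/-- **The cancellation pass**: from the equality of quotients `G₁ + G₂ = G₃ + G₄`, the mask and
adder definitions and `s(VL) = s(VR)`, the carry invariant propagates along the positions and
`Lᵢ ↔ Rᵢ` follows for all `i < W`. [cite: CookReckhow1979, §2] [cite: Krajicek1995, §9.2] -/
theorem pass (hG : ARulesOK G) (hsh : OShape W o₁ o₂ o₃ o₄) (sv₁ : SplitViews W o₁ b₁ K Γ) (sv₂ : SplitViews W o₂ b₂ K Γ)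
    (sv₃ : SplitViews W o₃ b₃ K Γ) (sv₄ : SplitViews W o₄ b₄ K Γ) (mv : MainViews W o₁ o₂ o₃ o₄ b₁ b₂ b₃ b₄ m K Γ)
    (hEQK : ctx K (Adder.invF (var (sel W o₁)) (var (sel W o₂)) (var (sel W o₃)) (var (sel W o₄))) ∈ Γ)
    (hmain : Holds K Γ (eqW (VL W o₁ o₂ b₁ b₂ m).s (VR W o₁ o₃ o₄ b₃ b₄ m).s (W + 2))) :
    G.Yields Γ (ctxSet K ((List.range (2 * W + 1)).map (passBody W o₁ o₂ o₃ o₄ b₁ b₂ b₃ b₄ m))) ((2 * W + 1) * (K.size + 59 + 1)) := by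
  rw [ctxSet_map_range]
  refine Yields.indexed (line := fun t => ctx K (passBody W o₁ o₂ o₃ o₄ b₁ b₂ b₃ b₄ m t)) (fun t ht => Or.inr ?_) fun t _ => by
    simpa [ctx, size] using size_passBody (W := W) (o₁ := o₁) (o₂ := o₂) (o₃ := o₃) (o₄ := o₄) (b₁ := b₁) (b₂ := b₂) (b₃ := b₃) (b₄ := b₄) (m := m) t
  show G.IsInferredFrom _ (ctx K (passBody W o₁ o₂ o₃ o₄ b₁ b₂ b₃ b₄ m t))
  obtain hr | hr := Nat.mod_two_eq_zero_or_one t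
  · by_cases ht0 : t = 0
    · -- the base: four false carry-ins
      rw [passBody_even hr, ht0, Nat.zero_div]
      exact FregeSystem.IsInferredFrom.of_rule (hG.adderLaw _ Adder.mem_lawRules.2.2.2.2.1)
        (FregeSystem.sub [K, var ((P W o₂ b₂).c 0), var ((VL W o₁ o₂ b₁ b₂ m).c 0), var ((P W o₄ b₄).c 0), var ((VR W o₁ o₃ o₄ b₃ b₄ m).c 0)]) rfl
        (FregeSystem.prems_cons (Or.inl sv₂.adder.1) (FregeSystem.prems_cons (Or.inl mv.vl.1) (FregeSystem.prems_cons (Or.inl sv₄.adder.1)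
          (FregeSystem.prems_cons (Or.inl mv.vr.1) FregeSystem.prems_nil))))
    · -- the invariant step at `i = t/2 - 1`
      obtain ⟨i, rfl⟩ : ∃ i, t = 2 * i + 2 := ⟨t / 2 - 1, by omega⟩
      have hi : i < W := by omega
      rw [passBody_even hr, show (2 * i + 2) / 2 = i + 1 by omega]
      exact Assoc.infer hG 10 (by decide) (σc K W o₁ o₂ o₃ o₄ b₁ b₂ b₃ b₄ m i) rfl
        (cancPrems_avail hsh Set.subset_union_left sv₁ sv₂ sv₃ sv₄ mv hEQK hmain hi
          (Or.inr ⟨2 * i, by omega, by rw [passBody_even (by omega), show 2 * i / 2 = i by omega]⟩))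
  · -- the equality `Lᵢ ↔ Rᵢ` at `i = t/2`
    obtain ⟨i, rfl⟩ : ∃ i, t = 2 * i + 1 := ⟨t / 2, by omega⟩
    have hi : i < W := by omega
    rw [passBody_odd hr, show (2 * i + 1) / 2 = i by omega]
    exact Assoc.infer hG 11 (by decide) (σc K W o₁ o₂ o₃ o₄ b₁ b₂ b₃ b₄ m i) rfl
      (cancPrems_avail hsh Set.subset_union_left sv₁ sv₂ sv₃ sv₄ mv hEQK hmain hi
        (Or.inr ⟨2 * i, by omega, by rw [passBody_even (by omega), show 2 * i / 2 = i by omega]⟩))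

/-- The equalities `Lᵢ ↔ Rᵢ` are among the pass lines. [folklore] -/
theorem eqv_mem_pass {i : ℕ} (hi : i < W) :
    eqv (u W o₂ i) (u W o₄ i) ∈ (List.range (2 * W + 1)).map (passBody W o₁ o₂ o₃ o₄ b₁ b₂ b₃ b₄ m) :=
  List.mem_map.2 ⟨2 * i + 1, List.mem_range.2 (by omega), by rw [passBody_odd (by omega), show (2 * i + 1) / 2 = i by omega]⟩

/-! ### The associativity law -/

/-- **Associativity of modular addition inside Frege.** For four available occurrences of the
modular-addition template in the shape `o₁ = x ⊕ₙ y`, `o₂ = u₁ ⊕ₙ z`, `o₃ = y ⊕ₙ z`,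
`o₄ = x ⊕ₙ u₃` (same `n`), their domain, split, main and quotient auxiliary occurrences, the
certificates `y < n`, `z < n`, `u₃ < n`, `L < n`, `R < n` and the global certificate `0 < n`, the
results agree: `Lᵢ ↔ Rᵢ` for all `i < W`, derived in size polynomial in `W` and `|K|`.
[cite: CookReckhow1979, §2] [cite: Krajicek1995, §9.2] -/
theorem _root_.Literature.Computability.MetaComplexity.ModAdd.assoc (hG : ARulesOK G) (hsh : OShape W o₁ o₂ o₃ o₄)
    (ho₁ : o₁.Avail (addModT W) (3 * W) K Γ) (ho₂ : o₂.Avail (addModT W) (3 * W) K Γ) (ho₃ : o₃.Avail (addModT W) (3 * W) K Γ)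
    (ho₄ : o₄.Avail (addModT W) (3 * W) K Γ) {a₁ a₂ a₃ a₄ : Occ}
    (ha₁ : a₁.Avail (domAuxT W) (4 * W + 1) K Γ) (hwa₁ : DomAux.Wired W o₁ a₁) (ha₂ : a₂.Avail (domAuxT W) (4 * W + 1) K Γ) (hwa₂ : DomAux.Wired W o₂ a₂)
    (ha₃ : a₃.Avail (domAuxT W) (4 * W + 1) K Γ) (hwa₃ : DomAux.Wired W o₃ a₃) (ha₄ : a₄.Avail (domAuxT W) (4 * W + 1) K Γ) (hwa₄ : DomAux.Wired W o₄ a₄)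
    (hb₁ : b₁.Avail (splitAuxT W) (2 * W + 2) K Γ) (hwb₁ : SWired W o₁ b₁) (hb₂ : b₂.Avail (splitAuxT W) (2 * W + 2) K Γ) (hwb₂ : SWired W o₂ b₂)
    (hb₃ : b₃.Avail (splitAuxT W) (2 * W + 2) K Γ) (hwb₃ : SWired W o₃ b₃) (hb₄ : b₄.Avail (splitAuxT W) (2 * W + 2) K Γ) (hwb₄ : SWired W o₄ b₄)
    (hm : m.Avail (mainAuxT W) (12 * W + 12) K Γ) (hwm : MWired W o₁ o₂ o₃ o₄ b₁ b₂ b₃ b₄ m)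
    (hqL : qL.Avail (quotAuxT W) (6 * W + 8) K Γ) (hwqL : QWired W o₁ o₁ o₂ b₁ b₂ qL (bL W m))
    (hqR : qR.Avail (quotAuxT W) (6 * W + 8) K Γ) (hwqR : QWired W o₁ o₃ o₄ b₃ b₄ qR (bR W m))
    (hy : LtN W K Γ (fun i => o₁.inp (W + i)) (nv W o₁)) (hz : LtN W K Γ (fun i => o₂.inp (W + i)) (nv W o₁))
    (hu₃ : LtN W K Γ (u W o₃) (nv W o₁)) (hL : LtN W K Γ (u W o₂) (nv W o₁)) (hR : LtN W K Γ (u W o₄) (nv W o₁))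
    {zw : ℕ → ℕ} (hzw : Holds K Γ (litW zw (fun _ => false) W)) (hzlt : LtN W K Γ zw (nv W o₁)) :
    G.Yields Γ (ctxSet K (eqW (u W o₂) (u W o₄) W)) ((1700 * W + 6000) * (K.size + 66)) := by
  have hΓ : ∀ {X : Set (PropForm ℕ)}, Γ ⊆ Γ ∪ X := fun {X} => Set.subset_union_left
  -- views
  have v₁ := avail ho₁
  have v₂ := avail ho₂
  have v₃ := avail ho₃
  have v₄ := avail ho₄
  have sv₁ := splitAvail hb₁ hwb₁
  have sv₂ := splitAvail hb₂ hwb₂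
  have sv₃ := splitAvail hb₃ hwb₃
  have sv₄ := splitAvail hb₄ hwb₄
  have mv := mainAvail hm hwm
  -- s1: the four split identities
  have s1 := (((splitSum hG.toRulesOK ho₁ ha₁ hwa₁ hb₁ hwb₁ hy).union
    (splitSum hG.toRulesOK ho₂ ha₂ hwa₂ hb₂ hwb₂ (hz.congr (fun _ _ => rfl) fun i hi => hsh.h₂n i hi))).union
    (splitSum hG.toRulesOK ho₃ ha₃ hwa₃ hb₃ hwb₃ (hz.congr (fun i hi => hsh.h₃y i hi) fun i hi => hsh.h₃n i hi))).union
    (splitSum hG.toRulesOK ho₄ ha₄ hwa₄ hb₄ hwb₄ (hu₃.congr (fun i hi => hsh.h₄y i hi) fun i hi => hsh.h₄n i hi))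
  set A1 := ((ctxSet K (splitBodies W o₁ b₁) ∪ ctxSet K (splitBodies W o₂ b₂)) ∪ ctxSet K (splitBodies W o₃ b₃)) ∪ ctxSet K (splitBodies W o₄ b₄)
    with hA1
  have hsp₁ : ∀ {X : Set (PropForm ℕ)}, A1 ⊆ X → Holds K (Γ ∪ X) (splitBodies W o₁ b₁) := fun hX =>
    holds_ctxSet fun θ hθ => Or.inr (hX (Or.inl (Or.inl (Or.inl hθ))))
  have hsp₂ : ∀ {X : Set (PropForm ℕ)}, A1 ⊆ X → Holds K (Γ ∪ X) (splitBodies W o₂ b₂) := fun hX =>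
    holds_ctxSet fun θ hθ => Or.inr (hX (Or.inl (Or.inl (Or.inr hθ))))
  have hsp₃ : ∀ {X : Set (PropForm ℕ)}, A1 ⊆ X → Holds K (Γ ∪ X) (splitBodies W o₃ b₃) := fun hX =>
    holds_ctxSet fun θ hθ => Or.inr (hX (Or.inl (Or.inr hθ)))
  have hsp₄ : ∀ {X : Set (PropForm ℕ)}, A1 ⊆ X → Holds K (Γ ∪ X) (splitBodies W o₄ b₄) := fun hX =>
    holds_ctxSet fun θ hθ => Or.inr (hX (Or.inr hθ))
  have hPc : ∀ (o b : Occ) {Y : Set (PropForm ℕ)}, Holds K Y (splitBodies W o b) → ctx K (neg (var ((P W o b).c (W + 1)))) ∈ Y := fun o b Y h =>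
    h _ (List.mem_append_right _ (List.mem_singleton_self _))
  -- s2: the identity between the sums
  have s2 := AssocMain.main hG hsh (v₁.mono (hΓ (X := A1))) (v₂.mono hΓ) (v₃.mono hΓ) (v₄.mono hΓ) (sv₁.mono hΓ) (sv₃.mono hΓ) (mv.mono hΓ)
    (hsp₁ subset_rfl) (hsp₂ subset_rfl) (hsp₃ subset_rfl) (hsp₄ subset_rfl)
  set A2 := A1 ∪ ctxSet K (eqW (VL W o₁ o₂ b₁ b₂ m).s (VR W o₁ o₃ o₄ b₃ b₄ m).s (W + 2)) with hA2
  have hmain : ∀ {X : Set (PropForm ℕ)}, A2 ⊆ X → Holds K (Γ ∪ X) (eqW (VL W o₁ o₂ b₁ b₂ m).s (VR W o₁ o₃ o₄ b₃ b₄ m).s (W + 2)) := fun hX =>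
    holds_ctxSet fun θ hθ => Or.inr (hX (Or.inr hθ))
  -- s3: the literals of the four `⊥` gates
  have s3 := (((Yields.lit_of_cstDef hG.logic (hΓ (X := A2) v₁.bot)).union (Yields.lit_of_cstDef hG.logic (hΓ v₂.bot))).union
    (Yields.lit_of_cstDef hG.logic (hΓ v₃.bot))).union (Yields.lit_of_cstDef hG.logic (hΓ v₄.bot))
  set A3 := A2 ∪ ((({ctx K (lit (f W o₁) false)} ∪ {ctx K (lit (f W o₂) false)}) ∪ {ctx K (lit (f W o₃) false)}) ∪ {ctx K (lit (f W o₄) false)})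
    with hA3
  have mf₁ : ∀ {X : Set (PropForm ℕ)}, A3 ⊆ X → ctx K (neg (var (f W o₁))) ∈ Γ ∪ X := fun hX => Or.inr (hX (Or.inr (Or.inl (Or.inl (Or.inl rfl)))))
  have mf₂ : ∀ {X : Set (PropForm ℕ)}, A3 ⊆ X → ctx K (neg (var (f W o₂))) ∈ Γ ∪ X := fun hX => Or.inr (hX (Or.inr (Or.inl (Or.inl (Or.inr rfl)))))
  have mf₃ : ∀ {X : Set (PropForm ℕ)}, A3 ⊆ X → ctx K (neg (var (f W o₃))) ∈ Γ ∪ X := fun hX => Or.inr (hX (Or.inr (Or.inl (Or.inr rfl))))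
  have mf₄ : ∀ {X : Set (PropForm ℕ)}, A3 ⊆ X → ctx K (neg (var (f W o₄))) ∈ Γ ∪ X := fun hX => Or.inr (hX (Or.inr (Or.inr rfl)))
  have i13 : A1 ⊆ A3 := fun θ hθ => Or.inl (Or.inl hθ)
  -- s4, s5: the quotient lines of both sides
  have s4 := AssocQuot.quot hG (Inst.DefsAvail.mono hqL (hΓ (X := A3))) hwqL (Inst.DefsAvail.mono hm hΓ) (fun h => (mainAvail h hwm).vl)
    (Inst.DefsAvail.mono hb₁ hΓ) hwb₁ (Inst.DefsAvail.mono hb₂ hΓ) hwb₂ (fun _ _ => rfl) (fun i hi => hsh.h₂n i hi)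
    (mf₁ subset_rfl) (mf₁ subset_rfl) (mf₂ subset_rfl) (hPc o₂ b₂ (hsp₂ i13)) (hL.mono hΓ) (hzw.mono hΓ) (hzlt.mono hΓ)
  set A4 := A3 ∪ ctxSet K (concl W o₁ o₁ o₂ b₁ b₂ qL (bL W m)) with hA4
  have i14 : A1 ⊆ A4 := fun θ hθ => Or.inl (i13 hθ)
  have s5 := AssocQuot.quot hG (Inst.DefsAvail.mono hqR (hΓ (X := A4))) hwqR (Inst.DefsAvail.mono hm hΓ) (fun h => (mainAvail h hwm).vr)
    (Inst.DefsAvail.mono hb₃ hΓ) hwb₃ (Inst.DefsAvail.mono hb₄ hΓ) hwb₄ (fun i hi => hsh.h₃n i hi) (fun i hi => hsh.h₄n i hi)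
    (mf₁ fun θ hθ => Or.inl hθ) (mf₃ fun θ hθ => Or.inl hθ) (mf₄ fun θ hθ => Or.inl hθ) (hPc o₄ b₄ (hsp₄ i14)) (hR.mono hΓ) (hzw.mono hΓ)
    (hzlt.mono hΓ)
  set A5 := A4 ∪ ctxSet K (concl W o₁ o₃ o₄ b₃ b₄ qR (bR W m)) with hA5
  have i35 : A3 ⊆ A5 := fun θ hθ => Or.inl (Or.inl hθ)
  -- s6: the top positions of `VL`, `VR`; s7: their (false) top carries are equal
  have s6 := (topCC hG (VL W o₁ o₂ b₁ b₂ m) (mv.vl.mono (hΓ (X := A5)))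
    (show Adder.extOut (P W o₂ b₂) (W + 1) (W + 1) = (P W o₂ b₂).c (W + 1) from Adder.extOut_top _ _)
    (show Adder.zext (N₁ W o₁ b₁) (f W o₁) (W + 1) (W + 1) = f W o₁ from Adder.zext_top _ _ _) (hPc o₂ b₂ (hsp₂ (i14.trans Set.subset_union_left)))
    (mf₁ i35)).union
    (topCC hG (VR W o₁ o₃ o₄ b₃ b₄ m) (mv.vr.mono (hΓ (X := A5)))
    (show Adder.extOut (P W o₄ b₄) (W + 1) (W + 1) = (P W o₄ b₄).c (W + 1) from Adder.extOut_top _ _)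
    (show Adder.zext (N₃ W o₃ b₃) (f W o₁) (W + 1) (W + 1) = f W o₁ from Adder.zext_top _ _ _) (hPc o₄ b₄ (hsp₄ (i14.trans Set.subset_union_left)))
    (mf₁ i35))
  set A6 := A5 ∪ (({ctx K (eqv ((VL W o₁ o₂ b₁ b₂ m).s (W + 1)) ((VL W o₁ o₂ b₁ b₂ m).c (W + 1)))} ∪ {ctx K (neg (var ((VL W o₁ o₂ b₁ b₂ m).c (W + 1 + 1))))}) ∪
    ({ctx K (eqv ((VR W o₁ o₃ o₄ b₃ b₄ m).s (W + 1)) ((VR W o₁ o₃ o₄ b₃ b₄ m).c (W + 1)))} ∪ {ctx K (neg (var ((VR W o₁ o₃ o₄ b₃ b₄ m).c (W + 1 + 1))))}))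
    with hA6
  have s7 := eqvFF hG (K := K) (Γ := Γ ∪ A6) (x := (VL W o₁ o₂ b₁ b₂ m).c (W + 2)) (y := (VR W o₁ o₃ o₄ b₃ b₄ m).c (W + 2))
    (Or.inr (Or.inr (Or.inl (Or.inr rfl)))) (Or.inr (Or.inr (Or.inr (Or.inr rfl))))
  set A7 := A6 ∪ {ctx K (eqv ((VL W o₁ o₂ b₁ b₂ m).c (W + 2)) ((VR W o₁ o₃ o₄ b₃ b₄ m).c (W + 2)))} with hA7
  -- s8: the comparison bits of both sides agree
  have s8 := eqG hG (quotAvail (Inst.DefsAvail.mono hqL (hΓ (X := A7))) hwqL) (quotAvail (Inst.DefsAvail.mono hqR hΓ) hwqR)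
    (hmain fun θ hθ => Or.inl (Or.inl (Or.inl (Or.inl (Or.inl hθ))))) (Or.inr (Or.inr rfl)) (mf₁ (i35.trans fun θ hθ => Or.inl (Or.inl hθ)))
  set A8 := A7 ∪ ({ctx K (eqv ((tD W o₁ o₁ o₂ b₁ b₂ qL (bL W m)).S₁.ge (W + 3) (W + 3)) ((tD W o₁ o₃ o₄ b₃ b₄ qR (bR W m)).S₁.ge (W + 3) (W + 3)))} ∪
    {ctx K (eqv ((tD W o₁ o₁ o₂ b₁ b₂ qL (bL W m)).S₃.ge (W + 3) (W + 3)) ((tD W o₁ o₃ o₄ b₃ b₄ qR (bR W m)).S₃.ge (W + 3) (W + 3)))}) with hA8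
  -- s9: equality of quotients `G₁ + G₂ = G₃ + G₄`
  have mcL : ∀ L ∈ concl W o₁ o₁ o₂ b₁ b₂ qL (bL W m), ctx K L ∈ Γ ∪ A8 := fun L hL => Or.inr (Or.inl (Or.inl (Or.inl (Or.inl (Or.inr (mem_ctxSet hL))))))
  have mcR : ∀ L ∈ concl W o₁ o₃ o₄ b₃ b₄ qR (bR W m), ctx K L ∈ Γ ∪ A8 := fun L hL => Or.inr (Or.inl (Or.inl (Or.inl (Or.inr (mem_ctxSet hL)))))
  have p0 : ctx K (biimp (var ((tD W o₁ o₁ o₂ b₁ b₂ qL (bL W m)).S₁.ge (W + 3) (W + 3))) (disj (var (sel W o₁)) (var (sel W o₂)))) ∈ Γ ∪ A8 :=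
    mcL _ (by simp [concl])
  have p1 : ctx K (biimp (var ((tD W o₁ o₁ o₂ b₁ b₂ qL (bL W m)).S₃.ge (W + 3) (W + 3))) (conj (var (sel W o₁)) (var (sel W o₂)))) ∈ Γ ∪ A8 :=
    mcL _ (by simp [concl])
  have p2 : ctx K (biimp (var ((tD W o₁ o₃ o₄ b₃ b₄ qR (bR W m)).S₁.ge (W + 3) (W + 3))) (disj (var (sel W o₃)) (var (sel W o₄)))) ∈ Γ ∪ A8 :=
    mcR _ (by simp [concl])
  have p3 : ctx K (biimp (var ((tD W o₁ o₃ o₄ b₃ b₄ qR (bR W m)).S₃.ge (W + 3) (W + 3))) (conj (var (sel W o₃)) (var (sel W o₄)))) ∈ Γ ∪ A8 :=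
    mcR _ (by simp [concl])
  have s9 : G.Yields (Γ ∪ A8) {ctx K (Adder.invF (var (sel W o₁)) (var (sel W o₂)) (var (sel W o₃)) (var (sel W o₄)))} (K.size + 60) := by
    have h := Yields.single (Assoc.infer hG 9 (by decide) (S := Γ ∪ A8)
      (FregeSystem.sub [K, var ((tD W o₁ o₁ o₂ b₁ b₂ qL (bL W m)).S₁.ge (W + 3) (W + 3)), var ((tD W o₁ o₁ o₂ b₁ b₂ qL (bL W m)).S₃.ge (W + 3) (W + 3)),
        var ((tD W o₁ o₃ o₄ b₃ b₄ qR (bR W m)).S₁.ge (W + 3) (W + 3)), var ((tD W o₁ o₃ o₄ b₃ b₄ qR (bR W m)).S₃.ge (W + 3) (W + 3)),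
        var (sel W o₁), var (sel W o₂), var (sel W o₃), var (sel W o₄)])
      (θ := ctx K (Adder.invF (var (sel W o₁)) (var (sel W o₂)) (var (sel W o₃)) (var (sel W o₄)))) rfl
      (FregeSystem.prems_cons p0 (FregeSystem.prems_cons p1 (FregeSystem.prems_cons p2 (FregeSystem.prems_cons p3
        (FregeSystem.prems_cons (Or.inr (Or.inr (Or.inl rfl))) (FregeSystem.prems_cons (Or.inr (Or.inr (Or.inr rfl))) FregeSystem.prems_nil)))))))
    exact h.mono_size (by simp [ctx, Adder.invF, size, FregeSystem.size_biimp])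
  set A9 := A8 ∪ {ctx K (Adder.invF (var (sel W o₁)) (var (sel W o₂)) (var (sel W o₃)) (var (sel W o₄)))} with hA9
  -- s10: the cancellation pass
  have s10 := pass hG hsh (sv₁.mono (hΓ (X := A9))) (sv₂.mono hΓ) (sv₃.mono hΓ) (sv₄.mono hΓ) (mv.mono hΓ) (Or.inr (Or.inr rfl))
    (hmain fun θ hθ => Or.inl (Or.inl (Or.inl (Or.inl (Or.inl (Or.inl (Or.inl hθ)))))))
  have h := ((((((((s1.trans s2).trans s3).trans s4).trans s5).trans s6).trans s7).trans s8).trans s9).trans s10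
  refine (h.mono_right ?_).mono_size ?_
  · rintro θ ⟨L, hL, rfl⟩
    obtain ⟨i, hi, rfl⟩ := List.mem_map.1 hL
    exact Or.inr (mem_ctxSet (eqv_mem_pass (List.mem_range.1 hi)))
  · simp only [length_mainAuxT]
    nlinarith [Nat.zero_le W, Nat.zero_le K.size]

end Assoc

end ModAdd

end Literature.Computability.MetaComplexity
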